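import Literature.NumberTheory.Transcendental.LinGroupKTaylor
import Literature.NumberTheory.Transcendental.PadicExpBallProofs
import Mathlib.Analysis.Normed.Group.Ultra
import Mathlib.Analysis.Normed.Field.Ultra
import HarnessLib

/-!
# Ultrametric bounds for the Taylor coefficients and the values of `p`-adic exponential polynomials along a frame

Topic `Literature/NumberTheory/Transcendental` (namespace `Literature.NumberTheory.Transcendental`,
grouping sub-namespace `LinGroupK`). Everything here is PROVED; one definition with a body
(`LinGroupK.Frame.expPolyVal`, the value of the exponential polynomial); no named facts.

This is the analytic half of the interpolation-free several-variable method of Gel'fond–Schneider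
in the `p`-ADIC case ([Waldschmidt1988, §6 Prop. 6.1] after Waldschmidt, Invent. Math. 63 (1981),
§3 — there Thm 3.1 and its `p`-adic twin "Théorème 3.1.p"; [Roy1992, §1]: "`K = ℂ` or `ℂ_p`"),
reduced to finite sums by the algebra of `LinGroupKTaylor.lean`. Over an ultrametric normed
`ℚ_p`-algebra field `K` and a frame `Φ = (A, B)` on `K^n` with all coefficients of norm `≤ ρ`,
`pρ ≤ 1` ("the subspace `V` is parametrised by a small basis"):

* `norm_taylorCoeff_le` — NATURAL DECAY: `‖tc_κ(R)‖ ≤ ‖R‖ (pρ)^{|κ|}` (`‖R‖` = max of the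
  coefficients; `‖1/ν!‖_p ≤ p^ν`, and `A^{s₀} ℓ_s^ν` is a product of `|κ|` forms of size `ρ`);
* `norm_taylorCoeff_wordDeriv_le` — words of invariant derivations with letters `φ(c)`,
  `‖c‖ ≤ 1`, do not increase Taylor coefficients beyond a shift of the index
  (`taylorCoeff_invDeriv`: `tc_κ(D_{φ(c)}R) = ∑ₖ cₖ(κₖ+1) tc_{κ+eₖ}(R)`);
* `norm_coeff_wordDeriv_le` — nor the coefficients of `R` (letters of norm `≤ 1`);
* `norm_eval_genPoly_le` — on the unit ball `‖u‖ ≤ 1`: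
  `‖genPoly_M(R)(u)‖ ≤ max(ε, ‖R‖(pρ)^L)` as soon as `‖tc_κ(R)‖ ≤ ε` for `|κ| < L ≤ M`;
* `Frame.expPolyVal` and `norm_expPolyVal_le` — in a COMPLETE extension `ι : K → E` (e.g.
  `ℚ̄_p ⊂ ℂ_p`), the value `Φ_R(u) = ∑_s r_s A(u)^{s₀} exp(ℓ_s(u))` of the exponential polynomial
  differs from `genPoly_L(R)(u)` by the tails of the exponential series, `≤ ‖R‖(pρ)^L`
  (`norm_exp_sub_truncExp_le`), whence **`‖Φ_R(u)‖ ≤ max(ε, ‖R‖(pρ)^L)`** — the smallness of the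
  auxiliary function at every point of the unit ball from the smallness of finitely many Taylor
  coefficients, with no Schwarz lemma and no maximum principle.

## References

* [Waldschmidt1988] M. Waldschmidt, *On the transcendence methods of Gel'fond and Schneider in
  several variables*, New Advances in Transcendence Theory (A. Baker ed.), CUP 1988, 375–398, §6
  Proposition 6.1 (p. 389) and its reference [15] (Invent. Math. 63 (1981)), Prop. 2.4 / Thm 3.1.
* [Roy1992] D. Roy, *Matrices whose coefficients are linear forms in logarithms*, J. Number Theory
  41 (1992) 22–47, Notations (p. 24), §1 (p. 25).
* N. Koblitz, *p-adic Numbers, p-adic Analysis, and Zeta-Functions*, GTM 58, Ch. IV §1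
  (`‖1/n!‖_p`, the exponential on its ball) — via `PadicExpBallProofs.lean`.
-/

noncomputable section

open MvPolynomial Finset IsUltrametricDist
open Literature.RingTheory.MvPolynomial (linForm linForm_apply isHomogeneous_linForm)

namespace Literature.NumberTheory.Transcendental

namespace LinGroupK

variable {p : ℕ} [Fact p.Prime]
variable {K : Type*} [NontriviallyNormedField K] [NormedAlgebra ℚ_[p] K] [IsUltrametricDist K]
variable {n d₀ d₁ : ℕ}

/-! ### Ultrametric bookkeeping for coefficients of polynomials -/

omit [NormedAlgebra ℚ_[p] K] in
/-- A finite sum of terms of norm `≤ c` (`c ≥ 0`) has norm `≤ c`. [folklore] -/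
theorem norm_sum_le_of_le {ι : Type*} (t : Finset ι) (f : ι → K) {c : ℝ} (hc : 0 ≤ c)
    (h : ∀ i ∈ t, ‖f i‖ ≤ c) : ‖∑ i ∈ t, f i‖ ≤ c :=
  IsUltrametricDist.norm_sum_le_of_forall_le_of_nonneg hc h

omit [NormedAlgebra ℚ_[p] K] in
/-- **Coefficients of a product**: if all coefficients of `φ` are `≤ a` and those of `ψ` are `≤ b`
then those of `φψ` are `≤ ab` (ultrametric). [folklore] -/
theorem norm_coeff_mul_le {σ : Type*} {φ ψ : MvPolynomial σ K} {a b : ℝ} (ha : 0 ≤ a) (hb : 0 ≤ b)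
    (hφ : ∀ κ, ‖coeff κ φ‖ ≤ a) (hψ : ∀ κ, ‖coeff κ ψ‖ ≤ b) (κ : σ →₀ ℕ) :
    ‖coeff κ (φ * ψ)‖ ≤ a * b := by
  classical
  rw [coeff_mul]
  refine norm_sum_le_of_le _ _ (mul_nonneg ha hb) fun x _ => ?_
  rw [norm_mul]
  exact mul_le_mul (hφ _) (hψ _) (norm_nonneg _) ha

omit [NormedAlgebra ℚ_[p] K] in
/-- Coefficients of a power. [folklore] -/
theorem norm_coeff_pow_le {σ : Type*} {φ : MvPolynomial σ K} {a : ℝ} (ha : 0 ≤ a)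
    (hφ : ∀ κ, ‖coeff κ φ‖ ≤ a) (ν : ℕ) (κ : σ →₀ ℕ) : ‖coeff κ (φ ^ ν)‖ ≤ a ^ ν := by
  induction ν generalizing κ with
  | zero =>
    classical
    rw [pow_zero, pow_zero, coeff_one]
    split_ifs <;> simp
  | succ ν ih =>
    rw [pow_succ, pow_succ]
    exact norm_coeff_mul_le (pow_nonneg ha _) ha ih hφ κ

omit [NormedAlgebra ℚ_[p] K] in
/-- Coefficients of a finite product. [folklore] -/
theorem norm_coeff_prod_le {σ ι : Type*} (t : Finset ι) {φ : ι → MvPolynomial σ K} {a : ι → ℝ}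
    (ha : ∀ i ∈ t, 0 ≤ a i) (hφ : ∀ i ∈ t, ∀ κ, ‖coeff κ (φ i)‖ ≤ a i) (κ : σ →₀ ℕ) :
    ‖coeff κ (∏ i ∈ t, φ i)‖ ≤ ∏ i ∈ t, a i := by
  classical
  induction t using Finset.induction_on generalizing κ with
  | empty =>
    rw [Finset.prod_empty, Finset.prod_empty, coeff_one]
    split_ifs <;> simp
  | insert i t hi ih =>
    rw [Finset.prod_insert hi, Finset.prod_insert hi]
    exact norm_coeff_mul_le (ha i (by simp)) (Finset.prod_nonneg fun j hj => ha j (by simp [hj]))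
      (hφ i (by simp)) (fun κ' => ih (fun j hj => ha j (by simp [hj]))
        (fun j hj => hφ j (by simp [hj])) κ') κ

omit [NormedAlgebra ℚ_[p] K] [IsUltrametricDist K] in
/-- Coefficients of `C a · φ`. [folklore] -/
theorem norm_coeff_C_mul_le {σ : Type*} {φ : MvPolynomial σ K} {b : ℝ} (a : K)
    (hφ : ∀ κ, ‖coeff κ φ‖ ≤ b) (κ : σ →₀ ℕ) : ‖coeff κ (C a * φ)‖ ≤ ‖a‖ * b := by
  rw [coeff_C_mul, norm_mul]
  exact mul_le_mul_of_nonneg_left (hφ κ) (norm_nonneg _)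

omit [NormedAlgebra ℚ_[p] K] in
/-- Coefficients of a linear form with coefficients of norm `≤ ρ`. [folklore] -/
theorem norm_coeff_linForm_le {c : Fin n → K} {ρ : ℝ} (hρ : 0 ≤ ρ) (hc : ∀ k, ‖c k‖ ≤ ρ)
    (κ : Fin n →₀ ℕ) : ‖coeff κ (linForm c : MvPolynomial (Fin n) K)‖ ≤ ρ := by
  classical
  rw [linForm_apply, coeff_sum]
  refine norm_sum_le_of_le _ _ hρ fun k _ => ?_
  rw [coeff_smul, coeff_X, smul_eq_mul]
  split_ifs
  · simpa using hc k
  · simpa using hρ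

omit [IsUltrametricDist K] in
include p in
/-- Natural numbers have norm `≤ 1` in `K`. [folklore] -/
theorem norm_natCast_le_one' (m : ℕ) : ‖(m : K)‖ ≤ 1 := PadicExp.norm_natCast_le_one (ℓ := p) m

omit [IsUltrametricDist K] in
/-- `‖(ν!)⁻¹‖ ≤ p^ν`. [folklore] -/
theorem norm_inv_factorial_le (ν : ℕ) : ‖((ν.factorial : ℕ) : K)⁻¹‖ ≤ (p : ℝ) ^ ν := by
  have hp : p.Prime := Fact.out
  refine (PadicExp.norm_inv_natCast_factorial_le (ℓ := p) (E := K) ν).trans ?_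
  exact pow_le_pow_right₀ (by exact_mod_cast hp.one_lt.le) (Nat.sub_le ν 1)

/-! ### Frames with small coefficients -/

namespace Frame

variable (Φ : Frame K n d₀ d₁)

/-- All coefficients of the frame have norm `≤ ρ`. [folklore] -/
def Small (ρ : ℝ) : Prop := (∀ i k, ‖Φ.A i k‖ ≤ ρ) ∧ ∀ j k, ‖Φ.B j k‖ ≤ ρ

variable {Φ}

/-- Coefficients of `A^{s₀}`: `≤ ρ^{|s₀|}`. [folklore] -/
theorem norm_coeff_monoX_le {ρ : ℝ} (hρ : 0 ≤ ρ) (hΦ : Φ.Small ρ) (s : Fin d₀ ⊕ Fin d₁ →₀ ℕ)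
    (κ : Fin n →₀ ℕ) : ‖coeff κ (Φ.monoX s)‖ ≤ ρ ^ ∑ i, s (Sum.inl i) := by
  rw [monoX, ← Finset.prod_pow_eq_pow_sum]
  exact norm_coeff_prod_le _ (fun i _ => pow_nonneg hρ _)
    (fun i _ κ' => norm_coeff_pow_le hρ (norm_coeff_linForm_le hρ (hΦ.1 i)) _ κ') κ

include p in
/-- Coefficients of `ℓ_s = ∑ⱼ s₁ⱼ Bⱼ`: `≤ ρ` (the `s₁ⱼ` are integers). [folklore] -/
theorem norm_coeff_formL_le {ρ : ℝ} (hρ : 0 ≤ ρ) (hΦ : Φ.Small ρ) (s : Fin d₀ ⊕ Fin d₁ →₀ ℕ)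
    (κ : Fin n →₀ ℕ) : ‖coeff κ (Φ.formL s)‖ ≤ ρ := by
  rw [formL, coeff_sum]
  refine norm_sum_le_of_le _ _ hρ fun j _ => ?_
  refine (norm_coeff_C_mul_le _ (norm_coeff_linForm_le hρ (hΦ.2 j)) κ).trans ?_
  exact mul_le_of_le_one_left hρ (norm_natCast_le_one' (p := p) _)

omit [NormedAlgebra ℚ_[p] K] [IsUltrametricDist K] in
/-- `A^{s₀} · ℓ_s^ν / ν!` is homogeneous of degree `|s₀| + ν`. [folklore] -/
theorem isHomogeneous_monoX_mul (s : Fin d₀ ⊕ Fin d₁ →₀ ℕ) (ν : ℕ) (a : K) :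
    (Φ.monoX s * (C a * Φ.formL s ^ ν)).IsHomogeneous ((∑ i, s (Sum.inl i)) + ν) := by
  refine IsHomogeneous.mul ?_ (by simpa using ((Φ.formL_isHomogeneous s).pow ν).C_mul a)
  rw [monoX]
  have := IsHomogeneous.prod (Finset.univ : Finset (Fin d₀)) (fun i => linForm (Φ.A i) ^ s (Sum.inl i))
    (fun i => s (Sum.inl i)) fun i _ => by simpa using (isHomogeneous_linForm (Φ.A i)).pow (s (Sum.inl i))
  simpa using this

/-- **The terms of a Taylor coefficient**:
`‖coeff_κ(A^{s₀} · ℓ_s^ν/ν!)‖ ≤ (pρ)^{|κ|}` (it vanishes unless `|κ| = |s₀| + ν`). [folklore] -/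
theorem norm_coeff_term_le {ρ : ℝ} (hρ : 0 ≤ ρ) (hΦ : Φ.Small ρ) (s : Fin d₀ ⊕ Fin d₁ →₀ ℕ) (ν : ℕ)
    (κ : Fin n →₀ ℕ) :
    ‖coeff κ (Φ.monoX s * (C (((ν.factorial : ℕ) : K)⁻¹) * Φ.formL s ^ ν))‖ ≤ ((p : ℝ) * ρ) ^ κ.degree := by
  have hp : p.Prime := Fact.out
  have hp1 : (1 : ℝ) ≤ p := by exact_mod_cast hp.one_lt.le
  by_cases hdeg : κ.degree = (∑ i, s (Sum.inl i)) + ν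
  · calc ‖coeff κ (Φ.monoX s * (C (((ν.factorial : ℕ) : K)⁻¹) * Φ.formL s ^ ν))‖
          ≤ ρ ^ (∑ i, s (Sum.inl i)) * ((p : ℝ) ^ ν * ρ ^ ν) := by
            refine norm_coeff_mul_le (pow_nonneg hρ _) (by positivity) (norm_coeff_monoX_le hρ hΦ s)
              (fun κ' => ?_) κ
            refine (norm_coeff_C_mul_le _ (norm_coeff_pow_le hρ (norm_coeff_formL_le (p := p) hρ hΦ s) ν) κ').trans ?_
            exact mul_le_mul_of_nonneg_right (norm_inv_factorial_le (p := p) ν) (pow_nonneg hρ _)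
      _ = (p : ℝ) ^ ν * ρ ^ κ.degree := by rw [hdeg, pow_add]; ring
      _ ≤ (p : ℝ) ^ κ.degree * ρ ^ κ.degree :=
          mul_le_mul_of_nonneg_right (pow_le_pow_right₀ hp1 (by omega)) (pow_nonneg hρ _)
      _ = ((p : ℝ) * ρ) ^ κ.degree := by rw [mul_pow]
  · rw [(isHomogeneous_monoX_mul s ν _).coeff_eq_zero hdeg, norm_zero]
    positivity

/-- Coefficients of `A^{s₀} · E_M(ℓ_s)`: `≤ (pρ)^{|κ|}`. [folklore] -/
theorem norm_coeff_monoX_mul_truncExp_le {ρ : ℝ} (hρ : 0 ≤ ρ) (hΦ : Φ.Small ρ)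
    (s : Fin d₀ ⊕ Fin d₁ →₀ ℕ) (M : ℕ) (κ : Fin n →₀ ℕ) :
    ‖coeff κ (Φ.monoX s * truncExp M (Φ.formL s))‖ ≤ ((p : ℝ) * ρ) ^ κ.degree := by
  rw [truncExp, Finset.mul_sum, coeff_sum]
  exact norm_sum_le_of_le _ _ (by positivity) fun ν _ => norm_coeff_term_le hρ hΦ s ν κ

omit [NormedAlgebra ℚ_[p] K] [IsUltrametricDist K] in
/-- `genPoly` as a sum over the support of `R`. [folklore] -/
theorem genPoly_eq_sum (M : ℕ) (R : MvPolynomial (Fin d₀ ⊕ Fin d₁) K) :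
    Φ.genPoly M R = ∑ s ∈ R.support, coeff s R • (Φ.monoX s * truncExp M (Φ.formL s)) := by
  conv_lhs => rw [R.as_sum, map_sum]
  exact Finset.sum_congr rfl fun s _ => by rw [genPoly_monomial]

/-- **Coefficients of the generating polynomial**: `‖coeff_κ(genPoly_M R)‖ ≤ ‖R‖ (pρ)^{|κ|}`.
[folklore] -/
theorem norm_coeff_genPoly_le {ρ cR : ℝ} (hρ : 0 ≤ ρ) (hΦ : Φ.Small ρ) (hcR : 0 ≤ cR)
    {R : MvPolynomial (Fin d₀ ⊕ Fin d₁) K} (hR : ∀ s, ‖coeff s R‖ ≤ cR) (M : ℕ) (κ : Fin n →₀ ℕ) :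
    ‖coeff κ (Φ.genPoly M R)‖ ≤ cR * ((p : ℝ) * ρ) ^ κ.degree := by
  rw [genPoly_eq_sum, coeff_sum]
  refine norm_sum_le_of_le _ _ (by positivity) fun s _ => ?_
  rw [coeff_smul, smul_eq_mul, norm_mul]
  exact mul_le_mul (hR s) (norm_coeff_monoX_mul_truncExp_le hρ hΦ s M κ) (norm_nonneg _) hcR

/-- **Natural decay of the Taylor coefficients**: `‖tc_κ(R)‖ ≤ ‖R‖ (pρ)^{|κ|}`.
[cite: Waldschmidt1988, §6 (p. 389)] -/
theorem norm_taylorCoeff_le {ρ cR : ℝ} (hρ : 0 ≤ ρ) (hΦ : Φ.Small ρ) (hcR : 0 ≤ cR)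
    {R : MvPolynomial (Fin d₀ ⊕ Fin d₁) K} (hR : ∀ s, ‖coeff s R‖ ≤ cR) (κ : Fin n →₀ ℕ) :
    ‖Φ.taylorCoeff κ R‖ ≤ cR * ((p : ℝ) * ρ) ^ κ.degree := by
  rw [taylorCoeff_apply]
  exact norm_coeff_genPoly_le hρ hΦ hcR hR _ κ

/-! ### Words of invariant derivations -/

include p in
/-- One letter: `‖tc_κ(D_{φ(c)} R)‖ ≤ ε` if `‖c‖ ≤ 1` and `‖tc_{κ'}(R)‖ ≤ ε` in degree `|κ| + 1`.
[folklore] -/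
theorem norm_taylorCoeff_invDeriv_le [CharZero K] {c : Fin n → K} (hc : ∀ k, ‖c k‖ ≤ 1) {ε : ℝ} (hε : 0 ≤ ε)
    {R : MvPolynomial (Fin d₀ ⊕ Fin d₁) K} (κ : Fin n →₀ ℕ)
    (hB : ∀ κ' : Fin n →₀ ℕ, κ'.degree = κ.degree + 1 → ‖Φ.taylorCoeff κ' R‖ ≤ ε) :
    ‖Φ.taylorCoeff κ (invDeriv (Φ.vec c) R)‖ ≤ ε := by
  rw [taylorCoeff_invDeriv]
  refine norm_sum_le_of_le _ _ hε fun k _ => ?_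
  rw [norm_mul, norm_mul]
  have h1 : ‖((κ k : ℕ) + 1 : K)‖ ≤ 1 := by exact_mod_cast norm_natCast_le_one' (p := p) (K := K) (κ k + 1)
  have h2 := hB (κ + Finsupp.single k 1) (by rw [map_add, Finsupp.degree_single])
  calc ‖c k‖ * (‖((κ k : ℕ) + 1 : K)‖ * ‖Φ.taylorCoeff (κ + Finsupp.single k 1) R‖) ≤ 1 * (1 * ε) := by
        gcongr
        exact hc k
    _ = ε := by ring

include p in
/-- **Words**: if the letters are `φ(c_l)` with `‖c_l‖ ≤ 1` and `‖tc_{κ'}(R)‖ ≤ ε` for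
`|κ| ≤ |κ'| ≤ |κ| + ℓ`, then `‖tc_κ(D_u R)‖ ≤ ε` for the word `u` of length `ℓ`.
[cite: Waldschmidt1988, §6 (p. 389: "the estimates for the derivatives")] -/
theorem norm_taylorCoeff_wordDeriv_le [CharZero K] {ℓ : ℕ} {cs : Fin ℓ → Fin n → K} (hc : ∀ l k, ‖cs l k‖ ≤ 1)
    {ε : ℝ} (hε : 0 ≤ ε) {R : MvPolynomial (Fin d₀ ⊕ Fin d₁) K} (κ : Fin n →₀ ℕ)
    (hB : ∀ κ' : Fin n →₀ ℕ, κ.degree ≤ κ'.degree → κ'.degree ≤ κ.degree + ℓ → ‖Φ.taylorCoeff κ' R‖ ≤ ε) :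
    ‖Φ.taylorCoeff κ (wordDeriv (fun l => Φ.vec (cs l)) R)‖ ≤ ε := by
  induction ℓ generalizing R κ with
  | zero => exact hB κ le_rfl (by omega)
  | succ ℓ ih =>
    rw [wordDeriv_succ]
    refine ih (cs := fun l => cs (Fin.castSucc l)) (fun l k => hc _ k) κ fun κ' h1 h2 => ?_
    refine norm_taylorCoeff_invDeriv_le (p := p) (hc _) hε κ' fun κ'' h3 => hB κ'' (by omega) (by omega)

include p in
/-- **Coefficients of `D_w R`**: `‖coeff_s(D_w R)‖ ≤ ‖R‖` if the coordinates of `w` have norm `≤ 1`.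
[folklore] -/
theorem norm_coeff_invDeriv_le {w : (Fin d₀ → K) × (Fin d₁ → K)} (hw0 : ∀ i, ‖w.1 i‖ ≤ 1)
    (hw1 : ∀ j, ‖w.2 j‖ ≤ 1) {cR : ℝ} (hcR : 0 ≤ cR) {R : MvPolynomial (Fin d₀ ⊕ Fin d₁) K}
    (hR : ∀ s, ‖coeff s R‖ ≤ cR) (s : Fin d₀ ⊕ Fin d₁ →₀ ℕ) : ‖coeff s (invDeriv w R)‖ ≤ cR := by
  classical
  rw [invDeriv_apply, coeff_add, coeff_sum, coeff_sum]
  refine (norm_add_le_max _ _).trans (max_le ?_ ?_)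
  · refine norm_sum_le_of_le _ _ hcR fun i _ => ?_
    rw [coeff_smul, coeff_pderiv, smul_eq_mul, norm_mul, norm_mul]
    calc ‖w.1 i‖ * (‖coeff (s + Finsupp.single (Sum.inl i) 1) R‖ * ‖((s (Sum.inl i) : K) + 1)‖) ≤
        1 * (cR * 1) := by
          gcongr
          · exact hw0 i
          · exact hR _
          · exact_mod_cast norm_natCast_le_one' (p := p) (K := K) (s (Sum.inl i) + 1)
      _ = cR := by ring
  · refine norm_sum_le_of_le _ _ hcR fun j _ => ?_
    rw [coeff_smul, smul_eq_mul, norm_mul, coeff_X_mul']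
    split_ifs with hj
    · rw [coeff_pderiv, norm_mul]
      have hs : s - Finsupp.single (Sum.inr j) 1 + Finsupp.single (Sum.inr j) 1 = s := by
        ext v
        simp only [Finsupp.coe_add, Finsupp.coe_tsub, Pi.add_apply, Pi.sub_apply, Finsupp.single_apply]
        split_ifs with h
        · subst h
          rw [Finsupp.mem_support_iff] at hj
          omega
        · simp
      rw [hs]
      set s' : Fin d₀ ⊕ Fin d₁ →₀ ℕ := s - Finsupp.single (Sum.inr j) 1 with hs'
      have h3 : ‖((s' (Sum.inr j) : K) + 1)‖ ≤ 1 := by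
        exact_mod_cast norm_natCast_le_one' (p := p) (K := K) (s' (Sum.inr j) + 1)
      calc ‖w.2 j‖ * (‖coeff s R‖ * ‖((s' (Sum.inr j) : K) + 1)‖) ≤ 1 * (cR * 1) := by
            gcongr
            · exact hw1 j
            · exact hR _
        _ = cR := by ring
    · rw [norm_zero, mul_zero]
      exact hcR

/-- Coordinates of `φ(c)` have norm `≤ ρ` if `‖c‖ ≤ 1`. [folklore] -/
theorem norm_vec_le {ρ : ℝ} (hρ : 0 ≤ ρ) (hΦ : Φ.Small ρ) {c : Fin n → K} (hc : ∀ k, ‖c k‖ ≤ 1) :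
    (∀ i, ‖(Φ.vec c).1 i‖ ≤ ρ) ∧ ∀ j, ‖(Φ.vec c).2 j‖ ≤ ρ := by
  constructor
  · intro i
    change ‖∑ k, c k * Φ.A i k‖ ≤ ρ
    refine norm_sum_le_of_le _ _ hρ fun k _ => ?_
    rw [norm_mul]
    calc ‖c k‖ * ‖Φ.A i k‖ ≤ 1 * ρ := by gcongr; exacts [hc k, hΦ.1 i k]
      _ = ρ := one_mul ρ
  · intro j
    change ‖∑ k, c k * Φ.B j k‖ ≤ ρ
    refine norm_sum_le_of_le _ _ hρ fun k _ => ?_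
    rw [norm_mul]
    calc ‖c k‖ * ‖Φ.B j k‖ ≤ 1 * ρ := by gcongr; exacts [hc k, hΦ.2 j k]
      _ = ρ := one_mul ρ

include p in
/-- **Coefficients of `D_u R` for a word** with letters `φ(c_l)`, `‖c_l‖ ≤ 1`, frame of size
`ρ ≤ 1`: `≤ ‖R‖`. [folklore] -/
theorem norm_coeff_wordDeriv_le {ρ : ℝ} (hρ : 0 ≤ ρ) (hρ1 : ρ ≤ 1) (hΦ : Φ.Small ρ) {ℓ : ℕ}
    {cs : Fin ℓ → Fin n → K} (hc : ∀ l k, ‖cs l k‖ ≤ 1) {cR : ℝ} (hcR : 0 ≤ cR)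
    {R : MvPolynomial (Fin d₀ ⊕ Fin d₁) K} (hR : ∀ s, ‖coeff s R‖ ≤ cR) (s : Fin d₀ ⊕ Fin d₁ →₀ ℕ) :
    ‖coeff s (wordDeriv (fun l => Φ.vec (cs l)) R)‖ ≤ cR := by
  induction ℓ generalizing R s with
  | zero => exact hR s
  | succ ℓ ih =>
    rw [wordDeriv_succ]
    refine ih (cs := fun l => cs (Fin.castSucc l)) (fun l k => hc _ k) (fun s' => ?_) s
    obtain ⟨h0, h1⟩ := norm_vec_le hρ hΦ (hc (Fin.last ℓ))
    exact norm_coeff_invDeriv_le (p := p) (fun i => (h0 i).trans hρ1) (fun j => (h1 j).trans hρ1) hcR hR s'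

/-! ### Values on the unit ball -/

omit [NormedAlgebra ℚ_[p] K] in
/-- **Ultrametric bound for the value of a polynomial** on the unit ball: `‖G(u)‖ ≤ max coeff`.
[folklore] -/
theorem norm_eval_le_of_coeff {σ : Type*} [Fintype σ] (G : MvPolynomial σ K) {u : σ → K}
    (hu : ∀ k, ‖u k‖ ≤ 1) {c : ℝ} (hc : 0 ≤ c) (hG : ∀ κ ∈ G.support, ‖coeff κ G‖ ≤ c) :
    ‖eval u G‖ ≤ c := by
  rw [eval_eq]
  refine norm_sum_le_of_le _ _ hc fun κ hκ => ?_
  rw [norm_mul, norm_prod]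
  refine (mul_le_of_le_one_right (norm_nonneg _) ?_).trans (hG κ hκ)
  exact Finset.prod_le_one (fun _ _ => norm_nonneg _) fun k _ => by
    rw [norm_pow]; exact pow_le_one₀ (norm_nonneg _) (hu k)

/-- **The generating polynomial is small on the unit ball** when the low Taylor coefficients are:
if `‖tc_κ(R)‖ ≤ ε` for `|κ| < L ≤ M` then `‖genPoly_M(R)(u)‖ ≤ max(ε, ‖R‖(pρ)^L)` for `‖u‖ ≤ 1`
(`pρ ≤ 1`). [cite: Waldschmidt1988, §6 (p. 389)] -/
theorem norm_eval_genPoly_le {ρ cR ε : ℝ} (hρ : 0 ≤ ρ) (hpρ : (p : ℝ) * ρ ≤ 1) (hΦ : Φ.Small ρ)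
    (hcR : 0 ≤ cR) (hε : 0 ≤ ε) {R : MvPolynomial (Fin d₀ ⊕ Fin d₁) K} (hR : ∀ s, ‖coeff s R‖ ≤ cR)
    {L M : ℕ} (hLM : L ≤ M) (htc : ∀ κ : Fin n →₀ ℕ, κ.degree < L → ‖Φ.taylorCoeff κ R‖ ≤ ε)
    {u : Fin n → K} (hu : ∀ k, ‖u k‖ ≤ 1) :
    ‖eval u (Φ.genPoly M R)‖ ≤ max ε (cR * ((p : ℝ) * ρ) ^ L) := by
  refine norm_eval_le_of_coeff _ hu (le_max_of_le_left hε) fun κ _ => ?_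
  by_cases hκ : κ.degree < L
  · rw [Φ.coeff_genPoly_eq_taylorCoeff κ (lt_of_lt_of_le hκ hLM)]
    exact (htc κ hκ).trans (le_max_left _ _)
  · refine (norm_coeff_genPoly_le hρ hΦ hcR hR M κ).trans ((mul_le_mul_of_nonneg_left
      (pow_le_pow_of_le_one (by positivity) hpρ (by omega)) hcR).trans (le_max_right _ _))

/-! ### The exponential polynomial in a complete extension -/

section Complete

variable {E : Type*} [NontriviallyNormedField E] [NormedAlgebra ℚ_[p] E] [IsUltrametricDist E]
  [CompleteSpace E] (ι : K →+* E)

variable (Φ) in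
/-- **The exponential polynomial of `R` along the frame**, evaluated at `u ∈ K^n` inside a complete
extension `ι : K → E`: `Φ_R(u) = ∑_s r_s · A(u)^{s₀} · exp(ℓ_s(u))`.
[cite: Waldschmidt1988, §6 Proposition 6.1 (p. 389)] -/
def expPolyVal (R : MvPolynomial (Fin d₀ ⊕ Fin d₁) K) (u : Fin n → K) : E :=
  ∑ s ∈ R.support, ι (coeff s R * eval u (Φ.monoX s)) * NormedSpace.exp (ι (eval u (Φ.formL s)))

omit [IsUltrametricDist K] in
/-- **Tail of the exponential series**: `‖exp x − ∑_{ν<M} x^ν/ν!‖ ≤ (p‖x‖)^M` for `‖x‖ < p⁻¹`.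
[folklore] -/
theorem norm_exp_sub_truncExp_le {x : E} (hx : ‖x‖ < (p : ℝ)⁻¹) (M : ℕ) :
    ‖NormedSpace.exp x - ∑ ν ∈ Finset.range M, x ^ ν / ((ν.factorial : ℕ) : E)‖ ≤ ((p : ℝ) * ‖x‖) ^ M := by
  have hp : p.Prime := Fact.out
  have hp0 : (0 : ℝ) < p := by exact_mod_cast hp.pos
  have hs := PadicExp.hasSum_exp (ℓ := p) hx
  rw [← hs.tsum_eq, ← hs.summable.sum_add_tsum_nat_add M, add_sub_cancel_left]
  have hpx : (p : ℝ) * ‖x‖ ≤ 1 := by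
    rw [← le_div_iff₀' hp0, one_div]
    exact hx.le
  refine norm_tsum_le_of_forall_le_of_nonneg (by positivity) fun ν => ?_
  calc ‖x ^ (ν + M) / (((ν + M).factorial : ℕ) : E)‖ ≤ ‖x‖ ^ (ν + M) * (p : ℝ) ^ (ν + M - 1) :=
        PadicExp.norm_pow_div_factorial_le (ℓ := p) x (ν + M)
    _ ≤ ‖x‖ ^ (ν + M) * (p : ℝ) ^ (ν + M) := by
        gcongr
        · exact_mod_cast hp.one_lt.le
        · exact Nat.sub_le _ _
    _ = ((p : ℝ) * ‖x‖) ^ (ν + M) := by rw [mul_pow]; ring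
    _ ≤ ((p : ℝ) * ‖x‖) ^ M := pow_le_pow_of_le_one (by positivity) hpx (by omega)

omit [IsUltrametricDist K] [CompleteSpace E] [IsUltrametricDist E] in
/-- Evaluation of a truncated exponential. [folklore] -/
theorem eval_truncExp (M : ℕ) (φ : MvPolynomial (Fin n) K) (u : Fin n → K) :
    ι (eval u (truncExp M φ)) = ∑ ν ∈ Finset.range M, (ι (eval u φ)) ^ ν / ((ν.factorial : ℕ) : E) := by
  rw [truncExp, map_sum, map_sum]
  refine Finset.sum_congr rfl fun ν _ => ?_
  simp only [map_mul, eval_C, map_pow, map_inv₀, map_natCast]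
  rw [div_eq_mul_inv, mul_comm]

/-- **The exponential polynomial against its generating polynomial**: on the unit ball, with a frame
of size `ρ`, `pρ < 1`... precisely `ρ < p⁻¹`: `‖Φ_R(u) − ι(genPoly_M(R)(u))‖ ≤ ‖R‖ (pρ)^M`.
[cite: Waldschmidt1988, §6 (p. 389)] -/
theorem norm_expPolyVal_sub_genPoly_le (hι : ∀ x, ‖ι x‖ = ‖x‖) {ρ cR : ℝ} (hρ : 0 ≤ ρ)
    (hρp : ρ < (p : ℝ)⁻¹) (hΦ : Φ.Small ρ) (hcR : 0 ≤ cR) {R : MvPolynomial (Fin d₀ ⊕ Fin d₁) K}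
    (hR : ∀ s, ‖coeff s R‖ ≤ cR) (M : ℕ) {u : Fin n → K} (hu : ∀ k, ‖u k‖ ≤ 1) :
    ‖Φ.expPolyVal ι R u - ι (eval u (Φ.genPoly M R))‖ ≤ cR * ((p : ℝ) * ρ) ^ M := by
  have hp : p.Prime := Fact.out
  rw [genPoly_eq_sum, map_sum, map_sum, expPolyVal, ← Finset.sum_sub_distrib]
  refine norm_sum_le_of_le _ _ (by positivity) fun s _ => ?_
  have e : ι (coeff s R * eval u (Φ.monoX s)) * NormedSpace.exp (ι (eval u (Φ.formL s))) -
        ι (eval u (coeff s R • (Φ.monoX s * truncExp M (Φ.formL s)))) =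
      ι (coeff s R) * (ι (eval u (Φ.monoX s)) *
        (NormedSpace.exp (ι (eval u (Φ.formL s))) - ι (eval u (truncExp M (Φ.formL s))))) := by
    rw [smul_eval, map_mul (eval u), map_mul, map_mul, map_mul]
    ring
  rw [e, norm_mul, norm_mul, hι, hι]
  -- `‖ℓ_s(u)‖ ≤ ρ < p⁻¹`
  have hℓ : ‖eval u (Φ.formL s)‖ ≤ ρ :=
    norm_eval_le_of_coeff _ hu hρ fun κ _ => norm_coeff_formL_le (p := p) hρ hΦ s κ
  have hℓ' : ‖ι (eval u (Φ.formL s))‖ < (p : ℝ)⁻¹ := by rw [hι]; exact lt_of_le_of_lt hℓ hρp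
  have hA : ‖eval u (Φ.monoX s)‖ ≤ 1 := by
    rw [monoX, map_prod, norm_prod]
    refine Finset.prod_le_one (fun _ _ => norm_nonneg _) fun i _ => ?_
    rw [map_pow, norm_pow]
    refine pow_le_one₀ (norm_nonneg _) ?_
    have hρ1 : ρ ≤ 1 := hρp.le.trans (inv_le_one_of_one_le₀ (by exact_mod_cast hp.one_lt.le))
    exact (norm_eval_le_of_coeff _ hu hρ fun κ _ => norm_coeff_linForm_le hρ (hΦ.1 i) κ).trans hρ1
  have htail := norm_exp_sub_truncExp_le hℓ' M
  rw [← eval_truncExp] at htail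
  calc ‖coeff s R‖ * (‖eval u (Φ.monoX s)‖ *
        ‖NormedSpace.exp (ι (eval u (Φ.formL s))) - ι (eval u (truncExp M (Φ.formL s)))‖)
      ≤ cR * (1 * ((p : ℝ) * ρ) ^ M) := by
        gcongr
        · exact hR s
        · refine htail.trans (pow_le_pow_left₀ (by positivity) ?_ M)
          rw [hι]
          exact mul_le_mul_of_nonneg_left hℓ (by positivity)
    _ = cR * ((p : ℝ) * ρ) ^ M := by ring

/-- **Smallness of the exponential polynomial on the unit ball from the smallness of its low Taylor
coefficients**: if `‖tc_κ(R)‖ ≤ ε` for `|κ| < L` then `‖Φ_R(u)‖ ≤ max(ε, ‖R‖(pρ)^L)` for all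
`‖u‖ ≤ 1` (`ρ < p⁻¹`). This is the `p`-adic "auxiliary function small on a ball" of
[Waldschmidt1988, Prop. 6.1], with no Schwarz lemma. [cite: Waldschmidt1988, §6 Proposition 6.1 (p. 389)] -/
theorem norm_expPolyVal_le [CharZero K] (hι : ∀ x, ‖ι x‖ = ‖x‖) {ρ cR ε : ℝ} (hρ : 0 ≤ ρ)
    (hρp : ρ < (p : ℝ)⁻¹) (hΦ : Φ.Small ρ) (hcR : 0 ≤ cR) (hε : 0 ≤ ε)
    {R : MvPolynomial (Fin d₀ ⊕ Fin d₁) K} (hR : ∀ s, ‖coeff s R‖ ≤ cR) {L : ℕ}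
    (htc : ∀ κ : Fin n →₀ ℕ, κ.degree < L → ‖Φ.taylorCoeff κ R‖ ≤ ε)
    {u : Fin n → K} (hu : ∀ k, ‖u k‖ ≤ 1) :
    ‖Φ.expPolyVal ι R u‖ ≤ max ε (cR * ((p : ℝ) * ρ) ^ L) := by
  have hp : p.Prime := Fact.out
  have hp0 : (0 : ℝ) < p := by exact_mod_cast hp.pos
  have hpρ : (p : ℝ) * ρ ≤ 1 := by
    rw [← le_div_iff₀' hp0, one_div]
    exact hρp.le
  have h1 := norm_expPolyVal_sub_genPoly_le ι hι hρ hρp hΦ hcR hR L hu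
  have h2 : ‖ι (eval u (Φ.genPoly L R))‖ ≤ max ε (cR * ((p : ℝ) * ρ) ^ L) := by
    rw [hι]
    exact norm_eval_genPoly_le hρ hpρ hΦ hcR hε hR le_rfl htc hu
  have e : Φ.expPolyVal ι R u = (Φ.expPolyVal ι R u - ι (eval u (Φ.genPoly L R))) +
      ι (eval u (Φ.genPoly L R)) := by ring
  rw [e]
  exact (norm_add_le_max _ _).trans (max_le (h1.trans (le_max_right _ _)) h2)

end Complete

end Frame

end LinGroupK

end Literature.NumberTheory.Transcendental
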